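import Summits.ResolutionOfSingularities.ResolutionOfSingularities.Theorems.HomologicalConductorNoZenoCompositeDominator
import Summits.ResolutionOfSingularities.ResolutionOfSingularities.Theorems.HomologicalConductorNoZenoCompositeDescent
import Summits.ResolutionOfSingularities.ResolutionOfSingularities.Theorems.HomologicalConductorNoZenoCaPrincipalReductions
import Summits.ResolutionOfSingularities.ResolutionOfSingularities.Theorems.HomologicalConductorNoZenoThreadDichotomy
import HarnessLib

/-!
# Crux `NoZenoR` / `NoZeno` (stmt-ResolutionOfSingularities-19943 / -16483) — COFINAL GLOBAL `V`-MINIMISERS along an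
# eternal thread and the GERM MEMBERSHIP / RESIDUAL DEPENDENCE of their ratios

Route `ResolutionOfSingularities/HomologicalConductor`, W4.4 chain, line `thread-composite` r1.4 §1e (author
res-L0-w44-strat-1 g13, `L/res-L0-w44-strat-1/line-thread-composite-r1.lean` db59e781669ba2b0 l.479–677, sorry-free
there; res-L0-w44-plan-1 ADDENDUM v25.7 (2) «BOOKED (A)»): the TREE HOME, DEF-FREE, of the §1e structure lemmas — the
normal form from which an attack on the slot-7 residual `Sig.NoDivisorialThreadBPZ` starts.

* `not_isRegularLocalRing_of_caThread` — every stage of a `ca`-thread (`ca(T_m) ⊆ P_m`, `P_m` a proper prime) is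
  singular (`Birth.span_ca_eq_top_of_isRegularLocalRing`, Iyengar–Takahashi 5.4 at a regular stage).
* `mul_inv_mem_of_valuation_le` — in a valuation ring, `v(x) ≤ v(y)`, `y ≠ 0` ⇒ `x·y⁻¹ ∈ V`.
* `exists_vmax_cofinal` — (A): `W ≤ V` valuation rings, `V` Noetherian and containing every stage, the `ca`-values
  drop along `W` (the line's `DropsAlong O A W`, UNFOLDED here) and every stage singular ⇒ for every `N` some stage
  `n ≥ N` carries a nonzero `y ∈ ca(T_n)` of GLOBALLY MINIMAL `V`-order among all nonzero `ca`-elements of all stages.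
* `exists_vmax_cofinal_of_thread` — (A) over the verbatim thread binders of the residual: the inserted hypothesis (Z)
  (`TowerDominated O A W → DropsAlong O A W`, both UNFOLDED), a `ca`-thread of primes, a DVR `V` dominating every germ
  `D_(n+1) = Parasite.locPrime (tower O A (n+1)) (P (n+1)) _` (the line's `germ O A P hP n`, by `rfl`).
* `mul_inv_mem_germ_of_vmax` — (R1): the ratios `y'·y⁻¹` (`y' ∈ ca(T_(n+1))`) of a `V`-minimal `y ∈ ca(T_(n+1))` lie
  in the germ `D_(n+2)` when `V` dominates it.
* `residueDep_of_vmax` — (R1′), here UNCONDITIONAL: past the escape stage the pair `(s, y'·y⁻¹)` is residually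
  dependent over `k` in the germ — (GRD) is the tree theorem `Sandwiched.germResidueDep` (p540358), not a hypothesis.

Binder convention as in `…NoZenoCompositeDominator` / `…CompositeDescent` / `…CompositeThread`: `(O) (A) (V|W)` before
the hypotheses; drop-in names for the line file's r1.5 «pure imports».  OURS (cell res-hironaka): AI-produced and
kernel-checked, weaker than expert review; nothing here is a statement of the manuscript under review (Hironaka 2017);
fact-free, counted 0.
-/

noncomputable section

-- single-problem summit: the doubled namespace component `ResolutionOfSingularities` is forced
set_option linter.dupNamespace false

namespace Summit.ResolutionOfSingularities.ResolutionOfSingularities.Theorems.NoZeno.CompositeDominator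

open IsLocalRing
open Summit.ResolutionOfSingularities.ResolutionOfSingularities.Theses.HomologicalConductor
open Summit.ResolutionOfSingularities.ResolutionOfSingularities.Theorems.NoZeno.Birth
open Summit.ResolutionOfSingularities.ResolutionOfSingularities.Theorems.NoZeno
open Literature.AlgebraicGeometry.Resolution

variable {k K : Type} [Field k] [Field K] [Algebra k K]

/-! ## Every stage of a `ca`-thread is singular -/

/-- Every stage of a `ca`-THREAD is singular: if `ca(T_m) ⊆ P_m` for a (proper) prime `P_m`, then `T_m` is not regular,
since at a regular stage `ca(T_m)` generates the unit ideal (`Birth.span_ca_eq_top_of_isRegularLocalRing`,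
Iyengar–Takahashi 5.4). (res-L0-w44-strat-1, `thread-composite` r1.4 §1e.) [this work; composition only] -/
theorem not_isRegularLocalRing_of_caThread (O : ValuationSubring K) (A : Subalgebra k K)
    (hk : ∀ c : k, algebraMap k K c ∈ O) (hA : A.FG) (hfr : IsFractionRing ↥A K)
    (hAO : A.toSubring ≤ O.toSubring)
    (P : ∀ m : ℕ, Ideal ↥(tower O A m)) (hP : ∀ m, (P m).IsPrime)
    (hca : ∀ (m : ℕ) (x : K) (hx : x ∈ tower O A m),
      x ∈ ca (tower O A m) → (⟨x, hx⟩ : ↥(tower O A m)) ∈ P m)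
    (m : ℕ) : ¬ IsRegularLocalRing ↥(tower O A m) := by
  intro hreg
  have htop := span_ca_eq_top_of_isRegularLocalRing O A hk hA hfr hAO m hreg (tower O A m) le_rfl
  have hle : Ideal.span {s : ↥(tower O A m) | (s : K) ∈ ca (tower O A m)} ≤ P m :=
    Ideal.span_le.mpr fun s hs => hca m (s : K) s.2 hs
  rw [htop, top_le_iff] at hle
  exact (hP m).ne_top hle

/-! ## Valuation-order bookkeeping -/

omit [Algebra k K] in
/-- In a valuation ring `V` of `K`: `V.valuation x ≤ V.valuation y` with `y ≠ 0` gives `x * y⁻¹ ∈ V`. [elementary] -/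
theorem mul_inv_mem_of_valuation_le (V : ValuationSubring K) {x y : K} (hy0 : y ≠ 0)
    (h : V.valuation x ≤ V.valuation y) : x * y⁻¹ ∈ V := by
  apply V.mem_of_valuation_le_one
  have hvy : V.valuation y ≠ 0 := by
    rw [ne_eq, Valuation.zero_iff]
    exact hy0
  rw [map_mul, map_inv₀]
  calc V.valuation x * (V.valuation y)⁻¹ ≤ V.valuation y * (V.valuation y)⁻¹ :=
        mul_le_mul_of_nonneg_right h (le_of_lt (inv_pos.mpr (zero_lt_iff.mpr hvy)))
    _ = 1 := mul_inv_cancel₀ hvy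

/-! ## (A) Cofinal global `V`-minimisers -/

/-- **(A) COFINAL GLOBAL `V`-MINIMISERS.**  Let `W ≤ V` be valuation rings with `V` Noetherian and containing every
stage, suppose the `ca`-values drop along `W` (the line's `DropsAlong O A W`, unfolded: past every singular stage some
later nonzero `ca`-value `y` has `y * x⁻¹ ∉ W` for all earlier nonzero `ca`-values `x`) and every stage is singular.
Then for every `N` some stage `n ≥ N` carries a nonzero `y ∈ ca(T_n)` whose `V`-order is MINIMAL among all nonzero
`ca`-elements of ALL stages (`V.valuation x ≤ V.valuation y` for every `x ∈ ca(T_m)`, every `m`): a maximal element of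
the principal `V`-ideals generated by `ca`-elements exists by noetherianity, and one drop along `W` from a global
minimiser yields a global minimiser at a later stage (`valuation_le_of_mul_inv_not_mem`).
(res-L0-w44-strat-1, `thread-composite` r1.4 §1e `exists_vmax_cofinal`.) [this work; elementary] -/
theorem exists_vmax_cofinal (O : ValuationSubring K) (A : Subalgebra k K) (V W : ValuationSubring K)
    (hWV : W ≤ V)
    (hW : ∀ m : ℕ, ¬ IsRegularLocalRing ↥(tower O A m) →
      ∃ m' : ℕ, m < m' ∧ ∃ y ∈ ca (tower O A m'), y ≠ 0 ∧ ∀ x ∈ ca (tower O A m), x ≠ 0 → y * x⁻¹ ∉ W)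
    (hVN : IsNoetherianRing ↥V) (hTV : ∀ m, ∀ x ∈ tower O A m, x ∈ V)
    (hsing : ∀ m, ¬ IsRegularLocalRing ↥(tower O A m)) (N : ℕ) :
    ∃ n : ℕ, N ≤ n ∧ ∃ y ∈ ca (tower O A n), y ≠ 0 ∧
      ∀ m : ℕ, ∀ x ∈ ca (tower O A m), V.valuation x ≤ V.valuation y := by
  classical
  haveI : IsNoetherianRing ↥V := hVN
  have hcaV : ∀ m, ∀ x ∈ ca (tower O A m), x ∈ V := fun m x hx => hTV m x (ca_subset _ hx)
  -- the principal ideals of `V` generated by nonzero `ca`-elements of the stages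
  let 𝒮 : Set (Ideal ↥V) :=
    {I | ∃ m : ℕ, ∃ y : K, ∃ hy : y ∈ ca (tower O A m), y ≠ 0 ∧ I = Ideal.span {(⟨y, hcaV m y hy⟩ : ↥V)}}
  obtain ⟨m₁, -, y₁, hy₁, hy₁0, -⟩ := hW 0 (hsing 0)
  have hne : 𝒮.Nonempty := ⟨_, m₁, y₁, hy₁, hy₁0, rfl⟩
  obtain ⟨M, ⟨m₀, y₀, hy₀, hy₀0, rfl⟩, hmax⟩ :=
    set_has_maximal_iff_noetherian.mpr (inferInstance : IsNoetherian ↥V ↥V) 𝒮 hne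
  -- `y₀` is a global minimiser of the `V`-order
  have hglob : ∀ m : ℕ, ∀ x ∈ ca (tower O A m), V.valuation x ≤ V.valuation y₀ := by
    intro m x hx
    by_cases hx0 : x = 0
    · rw [hx0, map_zero]
      exact zero_le
    rcases le_total (V.valuation x) (V.valuation y₀) with h | h
    · exact h
    rcases h.lt_or_eq with hlt | heq
    · exfalso
      refine hmax _ ⟨m, x, hx, hx0, rfl⟩ (lt_of_le_of_ne ?_ ?_)
      · rw [Ideal.span_singleton_le_iff_mem, Ideal.mem_span_singleton']
        refine ⟨⟨y₀ * x⁻¹, mul_inv_mem_of_valuation_le V hx0 hlt.le⟩, Subtype.ext ?_⟩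
        show y₀ * x⁻¹ * x = y₀
        rw [inv_mul_cancel_right₀ hx0]
      · intro hEq
        have hxmem : (⟨x, hcaV m x hx⟩ : ↥V) ∈ Ideal.span {(⟨y₀, hcaV m₀ y₀ hy₀⟩ : ↥V)} := by
          rw [hEq]
          exact Ideal.mem_span_singleton_self _
        obtain ⟨c, hc⟩ := Ideal.mem_span_singleton'.mp hxmem
        have hcK : (c : K) * y₀ = x := by
          have := congrArg (fun z : ↥V => (z : K)) hc
          simpa using this
        have hxle : V.valuation x ≤ V.valuation y₀ := by
          rw [← hcK, map_mul]
          calc V.valuation (c : K) * V.valuation y₀ ≤ 1 * V.valuation y₀ :=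
                mul_le_mul_of_nonneg_right (V.valuation_le_one c) zero_le
            _ = V.valuation y₀ := one_mul _
        exact (not_lt.mpr hxle) hlt
    · exact heq.ge
  -- one drop along `W` from a global minimiser yields a global minimiser at a later stage
  have step : ∀ (n : ℕ) (y : K), y ∈ ca (tower O A n) → y ≠ 0 →
      (∀ m : ℕ, ∀ x ∈ ca (tower O A m), V.valuation x ≤ V.valuation y) →
      ∃ n' : ℕ, n < n' ∧ ∃ y' ∈ ca (tower O A n'), y' ≠ 0 ∧
        ∀ m : ℕ, ∀ x ∈ ca (tower O A m), V.valuation x ≤ V.valuation y' := by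
    intro n y hy hy0 hg
    obtain ⟨n', hnn', y', hy', hy'0, hdrop⟩ := hW n (hsing n)
    have hle : V.valuation y ≤ V.valuation y' :=
      valuation_le_of_mul_inv_not_mem V W hWV hy0 (hdrop y hy hy0)
    exact ⟨n', hnn', y', hy', hy'0, fun m x hx => (hg m x hx).trans hle⟩
  induction N with
  | zero => exact ⟨m₀, Nat.zero_le _, y₀, hy₀, hy₀0, hglob⟩
  | succ N ih =>
    obtain ⟨n, hNn, y, hy, hy0, hg⟩ := ih
    obtain ⟨n', hnn', y', hy', hy'0, hg'⟩ := step n y hy hy0 hg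
    exact ⟨n', by omega, y', hy', hy'0, hg'⟩

open Summit.ResolutionOfSingularities.ResolutionOfSingularities.Theorems.NoZeno.SandwichCluster in
/-- **(A) IN THE THREAD.**  Over the binders of the residual `Sig.NoDivisorialThreadBPZ`: the inserted hypothesis (Z)
(every TOWER-DOMINATED valuation ring — `∀ m, ∀ s ∈ T_m, s ∈ W ∧ (s⁻¹ ∈ W → s⁻¹ ∈ O)` — sees the `ca`-values drop,
both predicates of the line unfolded), a `ca`-thread of primes `P`, and a DVR `V` dominating every germ
`D_(n+1) = (T_(n+1))_(P_(n+1))`.  `exists_dominator_le` supplies a tower-dominated `W ≤ V`, (Z) the drops along it,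
`not_isRegularLocalRing_of_caThread` the singularity of every stage; so global `V`-minimisers of the `ca`-values occur
cofinally. (res-L0-w44-strat-1, `thread-composite` r1.4 §1e `exists_vmax_cofinal_of_thread`; the line's `germ O A P hP n`
is `Parasite.locPrime (tower O A (n + 1)) (P (n + 1)) (hP (n + 1))` by `rfl`.) [this work; composition only] -/
theorem exists_vmax_cofinal_of_thread (O : ValuationSubring K) (A : Subalgebra k K)
    (hk : ∀ c : k, algebraMap k K c ∈ O) (hA : A.FG) (hfr : IsFractionRing ↥A K)
    (hAO : A.toSubring ≤ O.toSubring)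
    (hZ : ∀ W : ValuationSubring K, (∀ m : ℕ, ∀ s ∈ tower O A m, s ∈ W ∧ (s⁻¹ ∈ W → s⁻¹ ∈ O)) →
      ∀ m : ℕ, ¬ IsRegularLocalRing ↥(tower O A m) →
        ∃ m' : ℕ, m < m' ∧ ∃ y ∈ ca (tower O A m'), y ≠ 0 ∧ ∀ x ∈ ca (tower O A m), x ≠ 0 → y * x⁻¹ ∉ W)
    (P : ∀ m : ℕ, Ideal ↥(tower O A m)) (hP : ∀ m, (P m).IsPrime)
    (hca : ∀ (m : ℕ) (x : K) (hx : x ∈ tower O A m),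
      x ∈ ca (tower O A m) → (⟨x, hx⟩ : ↥(tower O A m)) ∈ P m)
    (V : ValuationSubring K) (hDVR : IsDiscreteValuationRing ↥V)
    (hdomV : ∀ n : ℕ,
      SubringDominates (Parasite.locPrime (tower O A (n + 1)) (P (n + 1)) (hP (n + 1))) V.toSubring)
    (N : ℕ) :
    ∃ n : ℕ, N ≤ n ∧ ∃ y ∈ ca (tower O A n), y ≠ 0 ∧
      ∀ m : ℕ, ∀ x ∈ ca (tower O A m), V.valuation x ≤ V.valuation y := by
  have hTV : ∀ m, ∀ x ∈ tower O A m, x ∈ V := fun m x hx =>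
    (hdomV m).1 (Parasite.mem_locPrime_of_mem _ _ _ (d2rc_mem_tower_of_le O A (Nat.le_succ m) hx))
  obtain ⟨W, hWV, hW⟩ := exists_dominator_le O A V hk hAO hTV
  haveI : IsDiscreteValuationRing ↥V := hDVR
  exact exists_vmax_cofinal O A V W hWV (hZ W hW) inferInstance hTV
    (not_isRegularLocalRing_of_caThread O A hk hA hfr hAO P hP hca) N

/-! ## (R1) Ratios of a `V`-minimal `ca`-element lie in the germ -/

open Summit.ResolutionOfSingularities.ResolutionOfSingularities.Theorems.NoZeno.SandwichCluster in
/-- **(R1) RATIOS OF A `V`-MINIMAL `ca`-ELEMENT LIE IN THE GERM.**  If `y ∈ ca(T_(n+1))`, `y ≠ 0`, has minimal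
`V`-order within `ca(T_(n+1))` and `V` dominates the germ `D_(n+2) = (T_(n+2))_(P_(n+2))`, then `y' * y⁻¹ ∈ D_(n+2)` for
every `y' ∈ ca(T_(n+1))`: with `g` an admissible (`O`-minimal) denominator (`Thread.exists_admissible_tower`),
`y'·g⁻¹, y·g⁻¹ ∈ chart ⊆ T_(n+2) ⊆ D_(n+2)`, and `g·y⁻¹ ∈ V` is the inverse of the germ element `y·g⁻¹`, so lies in
the germ by DOMINATION. (res-L0-w44-strat-1, `thread-composite` r1.4 §1e `mul_inv_mem_germ_of_vmax`.)
[this work; elementary over `Thread.exists_admissible_tower`, `mul_inv_mem_chart`, `chart_le_loc_nrm_chart`] -/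
theorem mul_inv_mem_germ_of_vmax (O : ValuationSubring K) (A : Subalgebra k K)
    (hk : ∀ c : k, algebraMap k K c ∈ O) (hA : A.FG) (hfr : IsFractionRing ↥A K)
    (hAO : A.toSubring ≤ O.toSubring)
    (P : ∀ m : ℕ, Ideal ↥(tower O A m)) (hP : ∀ m, (P m).IsPrime) (V : ValuationSubring K) (n : ℕ)
    (hdom : SubringDominates (Parasite.locPrime (tower O A (n + 1 + 1)) (P (n + 1 + 1)) (hP (n + 1 + 1)))
      V.toSubring)
    {y y' : K} (hy : y ∈ ca (tower O A (n + 1))) (hy0 : y ≠ 0)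
    (hvmax : ∀ x ∈ ca (tower O A (n + 1)), V.valuation x ≤ V.valuation y)
    (hy' : y' ∈ ca (tower O A (n + 1))) :
    y' * y⁻¹ ∈ Parasite.locPrime (tower O A (n + 1 + 1)) (P (n + 1 + 1)) (hP (n + 1 + 1)) := by
  -- an admissible (`O`-minimal) denominator `g` of `ca(T_(n+1))`
  obtain ⟨g, hg, hg0, hmin⟩ := Thread.exists_admissible_tower O A hk hA hfr hAO (n + 1)
  -- chart ratios lie in `T_(n+2) ⊆ D_(n+2)`
  have hchart : ∀ c ∈ ca (tower O A (n + 1)),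
      c * g⁻¹ ∈ Parasite.locPrime (tower O A (n + 1 + 1)) (P (n + 1 + 1)) (hP (n + 1 + 1)) := fun c hc => by
    have h1 : c * g⁻¹ ∈ tower O A (n + 1 + 1) := by
      rw [tower_succ]
      exact chart_le_loc_nrm_chart O _ (mul_inv_mem_chart O _ hc hg hg0 hmin)
    exact Parasite.mem_locPrime_of_mem _ _ _ h1
  -- `g·y⁻¹ ∈ V` is the inverse of the germ element `y·g⁻¹`, hence in the germ by domination
  have hgy : g * y⁻¹ ∈ Parasite.locPrime (tower O A (n + 1 + 1)) (P (n + 1 + 1)) (hP (n + 1 + 1)) := by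
    have h := hdom.2 (y * g⁻¹) (hchart y hy)
    rw [mul_inv_rev, inv_inv] at h
    exact h (mul_inv_mem_of_valuation_le V hy0 (hvmax g hg))
  have heq : y' * y⁻¹ = (y' * g⁻¹) * (g * y⁻¹) := by
    rw [mul_assoc, ← mul_assoc g⁻¹, inv_mul_cancel₀ hg0, one_mul]
  rw [heq]
  exact Subring.mul_mem _ (hchart y' hy') hgy

/-! ## (R1′) Residual dependence of the `V`-leading ratios — unconditional -/

open Summit.ResolutionOfSingularities.ResolutionOfSingularities.Theorems.NoZeno.SandwichCluster in
/-- **(R1′) RESIDUAL DEPENDENCE OF THE `V`-LEADING RATIOS.**  Under the thread binders (tr.deg 3, a compatible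
`ca`-thread of primes `P`, the escape element `s ∈ T_(mₑ)` with `O.valuation s < 1`, `s ∉ P mₑ`): past the escape stage,
for a `V`-minimal `y ∈ ca(T_(n+1))`, any `y' ∈ ca(T_(n+1))`, and `V` dominating the germ `D_(n+2)`, the pair
`(s, y'·y⁻¹)` satisfies a non-trivial polynomial relation over `k` modulo the maximal ideal of `D_(n+2)` — the
`V`-initial forms of `ca(T_(n+1))` are residually of transcendence degree ≤ 1 over `k` together with `s̄`.
(res-L0-w44-strat-1, `thread-composite` r1.4 §1e `residueDep_of_vmax`; UNCONDITIONAL here: the line's hypothesis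
`hdep : Sig.GermResidueDep` is the tree theorem `Sandwiched.germResidueDep`, p540358.) [this work; composition only] -/
theorem residueDep_of_vmax (O : ValuationSubring K) (A : Subalgebra k K)
    (hk : ∀ c : k, algebraMap k K c ∈ O) (hA : A.FG) (hfr : IsFractionRing ↥A K)
    (hAO : A.toSubring ≤ O.toSubring) (htr : Algebra.trdeg k K = 3)
    (P : ∀ m : ℕ, Ideal ↥(tower O A m)) (hP : ∀ m, (P m).IsPrime)
    (hcompat : ∀ (m : ℕ) (x : K) (hx : x ∈ tower O A m) (hx' : x ∈ tower O A (m + 1)),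
      (⟨x, hx'⟩ : ↥(tower O A (m + 1))) ∈ P (m + 1) ↔ (⟨x, hx⟩ : ↥(tower O A m)) ∈ P m)
    (hca : ∀ (m : ℕ) (x : K) (hx : x ∈ tower O A m),
      x ∈ ca (tower O A m) → (⟨x, hx⟩ : ↥(tower O A m)) ∈ P m)
    (mₑ : ℕ) (s : K) (hsT : s ∈ tower O A mₑ) (hvs : O.valuation s < 1)
    (hsP : (⟨s, hsT⟩ : ↥(tower O A mₑ)) ∉ P mₑ)
    (V : ValuationSubring K) (n : ℕ) (hn : mₑ ≤ n + 1)
    (hdom : SubringDominates (Parasite.locPrime (tower O A (n + 1 + 1)) (P (n + 1 + 1)) (hP (n + 1 + 1)))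
      V.toSubring)
    {y y' : K} (hy : y ∈ ca (tower O A (n + 1))) (hy0 : y ≠ 0)
    (hvmax : ∀ x ∈ ca (tower O A (n + 1)), V.valuation x ≤ V.valuation y)
    (hy' : y' ∈ ca (tower O A (n + 1))) :
    ∃ f : MvPolynomial (Fin 2) k, f ≠ 0 ∧
      (MvPolynomial.aeval ![s, y' * y⁻¹] f = 0 ∨
        (MvPolynomial.aeval ![s, y' * y⁻¹] f)⁻¹ ∉
          Parasite.locPrime (tower O A (n + 1 + 1)) (P (n + 1 + 1)) (hP (n + 1 + 1))) := by
  have hsg : s ∈ Parasite.locPrime (tower O A (n + 1 + 1)) (P (n + 1 + 1)) (hP (n + 1 + 1)) :=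
    Parasite.mem_locPrime_of_mem _ _ _ (d2rc_mem_tower_of_le O A (hn.trans (Nat.le_succ _)) hsT)
  have hz : ∀ i, (![s, y' * y⁻¹] : Fin 2 → K) i ∈
      Parasite.locPrime (tower O A (n + 1 + 1)) (P (n + 1 + 1)) (hP (n + 1 + 1)) := fun i => by
    fin_cases i
    · exact hsg
    · exact mul_inv_mem_germ_of_vmax O A hk hA hfr hAO P hP V n hdom hy hy0 hvmax hy'
  exact Sandwiched.germResidueDep O A hk hA hfr hAO htr P hP hcompat hca mₑ s hsT hvs hsP (n + 1) hn _ hz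

end Summit.ResolutionOfSingularities.ResolutionOfSingularities.Theorems.NoZeno.CompositeDominator

end
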